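import Mathlib
import Summits.NavierStokesRegularity.NavierStokesRegularity.Theorems.TaoLadderRungTwoBreakBlowupRigidityOnePeriodicCompanionBounded
import Summits.NavierStokesRegularity.NavierStokesRegularity.Theses.TaoLadderRungTwoBreak
import HarnessLib

/-!
# K2(1) `TaoLadderRungTwoBreak.BlowupRigidityOne` (stmt-NavierStokesRegularity-20206) and K1(1)
  `NoSurvivingDSSOne` RESTATED BY NAME in eternal-solution language: «robust blow-up ⇒ a uniformly bounded
  SHIFT-PERIODIC surviving admissible eternal solution» / «no such solution» — the ONE-STUB form of the crux

Sequel to `…PeriodicCompanion` (p819377) and `…PeriodicCompanionBounded` (p819433). MODEL lattice ODEs only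
(Tao 2016 §4 (4.8) in the self-similar variables of §6.4; cell vocabulary); nothing in this file is a statement
about the Navier–Stokes equations, and NO item is closed by it (`--supports stmt-NavierStokesRegularity-20206`).
Pure logic over the landed dictionary `exists_survivingDSSWave_iff_shiftPeriodic`.

* `blowupRigidityOne_iff_periodicExtraction` — **the crux K2(1) BY NAME is EQUIVALENT to the ONE-STUB
  statement**: below a threshold, robust blow-up (`NoGlobalCascade`) of an `E₂(R)` table from a one-shell datum
  yields a UNIFORMLY BOUNDED admissible eternal solution of the renormalised INVISCID lattice that is
  SHIFT-PERIODIC (`W_{n+q}(σ) = W_n(σ - qT)`, `q ≥ 1`, `T > 0`, sub-unitary ratio `e^{2T} < (1+ε₀)^5`) and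
  (S₁)-surviving forward. Read against the route's LIVE consequence-crux K2ᵛ(1) `EternalRigidityViscBddOne`
  (⟨20420⟩: «… yields ν̂ ≥ 0 and a uniformly bounded admissible viscous eternal solution surviving forward»):
  K2(1) = K2ᵛ(1) restricted to ν̂ = 0 PLUS shift-periodicity PLUS sub-unitarity — the honest extra content of
  the rev-1 crux over the re-glued one (`eternalRigidityViscBddOne_of_periodicExtraction`);
* `noSurvivingDSSOne_iff_noPeriodicEternalBdd` — K1(1) BY NAME is EQUIVALENT to: below a threshold, no
  `E₂(R)` table carries a uniformly bounded shift-periodic (`T > 0`, `μ < 1`) admissible eternal solution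
  surviving forward; whence the tree's `(ρ0) NoSurvivingEternalBddOne ⇒ K1(1)`
  (`NoSurvivingEternalViscBddOne.noSurvivingDSSOne_of_noSurvivingEternalBddOne`, already landed) is the
  forgetting of periodicity.

HONEST LABEL: restatements; nothing is proved about robust blow-up or about surviving eternal solutions; no
stub, crux or summit is proved; rung 0. RE-LINE NOTE (planner's call, not this hand's): the two registered stubs
of ⟨20206⟩ (extraction `stub_eternalFromBlowup` + classification `stub_eternalIsDSS`) can be replaced by the
single right-hand side of `blowupRigidityOne_iff_periodicExtraction` («periodic extraction»), which is
literally equivalent to the crux.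
-/

noncomputable section

-- the summit and its single sub-problem share the name (CONVENTIONS §1)
set_option linter.dupNamespace false

open Set Filter Topology MeasureTheory

namespace Summit.NavierStokesRegularity.NavierStokesRegularity.Theorems

namespace BlowupRigidityOne

open Literature.Analysis.FluidPDE Literature.Analysis.FluidPDE.TaoCascade
open Summit.NavierStokesRegularity.NavierStokesRegularity.Theses.TaoLadderRungTwoBreak

/-- **K2(1) BY NAME ⟺ PERIODIC EXTRACTION.** `BlowupRigidityOne` holds iff below a threshold every robust
blow-up of an `E₂(R)` table from a one-shell datum yields a uniformly bounded, shift-periodic (`q ≥ 1`, `T > 0`,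
`e^{2T}/(1+ε₀)^5 < 1`), forward-(S₁)-surviving admissible eternal solution of the renormalised inviscid lattice.
[cite: Tao2016AveragedNS, §4 Thm. 4.2 (statement shape), Lemma 4.1 (4.8), §6.4; cell vocabulary (`NoGlobalCascade`, `IsEternal`, `UniformBound`, `EternalSurvivingFwd`, `IsDSSWave`, `Surviving`)] -/
theorem blowupRigidityOne_iff_periodicExtraction :
    BlowupRigidityOne ↔
    (∀ R : ℝ, 1 ≤ R → ∃ εs : ℝ, 0 < εs ∧ ∀ ε₀ : ℝ, 0 < ε₀ → ε₀ ≤ εs →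
      ∀ (α : Fin 4 → Fin 4 → Fin 4 → ℤ × ℤ × ℤ → ℝ) (X₀ : Fin 4 → ℝ), InTableClass R α →
        NoGlobalCascade ε₀ α X₀ →
        ∃ (W : ℤ → ℝ → Em 4) (q : ℕ) (T : ℝ), 0 < q ∧ 0 < T ∧ dssMu ε₀ T < 1 ∧
          IsEternal ε₀ α W ∧ UniformBound W ∧
          (∀ (n : ℤ) (σ : ℝ), W (n + q) σ = W n (σ - q * T)) ∧ EternalSurvivingFwd 1 ε₀ W) := by
  unfold BlowupRigidityOne
  refine forall_congr' fun R => forall_congr' fun _ => exists_congr fun εs => and_congr_right fun _ =>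
    forall_congr' fun ε₀ => forall_congr' fun hε => forall_congr' fun _ => forall_congr' fun α =>
    forall_congr' fun _ => forall_congr' fun _ => forall_congr' fun _ => ?_
  exact exists_survivingDSSWave_iff_shiftPeriodic hε

/-- **Periodic extraction ⇒ K2ᵛ(1) `EternalRigidityViscBddOne` (⟨20420⟩, the route's live consequence-crux)**:
forget periodicity and sub-unitarity, embed with `ν̂ = 0`. (Equivalently `eternalRigidityViscBddOne_of_blowupRigidityOne`
after `blowupRigidityOne_iff_periodicExtraction`; spelled out to display what K2(1) asks beyond K2ᵛ(1).)
[cite: Tao2016AveragedNS, §4 Thm. 4.2 (statement shape), §6.4; cell vocabulary (`IsEternalVisc`, `UniformBound`)] -/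
theorem eternalRigidityViscBddOne_of_periodicExtraction
    (H : ∀ R : ℝ, 1 ≤ R → ∃ εs : ℝ, 0 < εs ∧ ∀ ε₀ : ℝ, 0 < ε₀ → ε₀ ≤ εs →
      ∀ (α : Fin 4 → Fin 4 → Fin 4 → ℤ × ℤ × ℤ → ℝ) (X₀ : Fin 4 → ℝ), InTableClass R α →
        NoGlobalCascade ε₀ α X₀ →
        ∃ (W : ℤ → ℝ → Em 4) (q : ℕ) (T : ℝ), 0 < q ∧ 0 < T ∧ dssMu ε₀ T < 1 ∧
          IsEternal ε₀ α W ∧ UniformBound W ∧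
          (∀ (n : ℤ) (σ : ℝ), W (n + q) σ = W n (σ - q * T)) ∧ EternalSurvivingFwd 1 ε₀ W) :
    EternalRigidityViscBddOne := by
  intro R hR
  obtain ⟨εs, hεs, hH⟩ := H R hR
  refine ⟨εs, hεs, fun ε₀ hε hle α X₀ hα hNG => ?_⟩
  obtain ⟨W, q, T, -, -, -, hW, hU, -, hS⟩ := hH ε₀ hε hle α X₀ hα hNG
  exact ⟨0, W, hW.isEternalVisc, hU, hS⟩

/-- **K1(1) BY NAME ⟺ NO BOUNDED SHIFT-PERIODIC SURVIVING ETERNAL SOLUTION.** `NoSurvivingDSSOne` holds iff below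
a threshold no `E₂(R)` table carries a uniformly bounded admissible eternal solution of the renormalised inviscid
lattice that is shift-periodic (`q ≥ 1`, `T > 0`, `e^{2T}/(1+ε₀)^5 < 1`) and forward-(S₁)-surviving.
[cite: Tao2016AveragedNS, §4 Thm. 4.2 (statement shape), Lemma 4.1 (4.8), §6.4; cell vocabulary] -/
theorem noSurvivingDSSOne_iff_noPeriodicEternalBdd :
    NoSurvivingDSSOne ↔
    (∀ R : ℝ, 1 ≤ R → ∃ εs : ℝ, 0 < εs ∧ ∀ ε₀ : ℝ, 0 < ε₀ → ε₀ ≤ εs →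
      ∀ α : Fin 4 → Fin 4 → Fin 4 → ℤ × ℤ × ℤ → ℝ, InTableClass R α →
        ∀ (W : ℤ → ℝ → Em 4) (q : ℕ) (T : ℝ), 0 < q → 0 < T → dssMu ε₀ T < 1 →
          IsEternal ε₀ α W → UniformBound W →
          (∀ (n : ℤ) (σ : ℝ), W (n + q) σ = W n (σ - q * T)) → ¬ EternalSurvivingFwd 1 ε₀ W) := by
  unfold NoSurvivingDSSOne
  refine forall_congr' fun R => forall_congr' fun _ => exists_congr fun εs => and_congr_right fun _ =>
    forall_congr' fun ε₀ => forall_congr' fun hε => forall_congr' fun _ => forall_congr' fun α =>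
    forall_congr' fun _ => ?_
  have key := exists_survivingDSSWave_iff_shiftPeriodic (m := 4) hε (α := α)
  constructor
  · intro h W q T hq hT hμ hW hU hper hS
    obtain ⟨q', π, T', Φ, hW', hS', r, x, hne⟩ := key.2 ⟨W, q, T, hq, hT, hμ, hW, hU, hper, hS⟩
    exact hne (h q' π T' Φ hW' hS' r x)
  · intro h q π T Φ hW hS r x
    by_contra hne
    obtain ⟨W, q', T', hq', hT', hμ, hW', hU, hper, hS''⟩ := key.1 ⟨q, π, T, Φ, hW, hS, r, x, hne⟩
    exact h W q' T' hq' hT' hμ hW' hU hper hS''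

end BlowupRigidityOne

end Summit.NavierStokesRegularity.NavierStokesRegularity.Theorems

end
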